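import Summits.Ventures.CertifiedManyBodySolver.Downfold.RouterWordScore

/-!
# C-MO SI-6′ (ii) — the spin-inert PILOT's reading rule and verdict grammar (lead g28 RULING R-vj (C)/(D), 2026-08-29T15:56Z)
# as total functions, with the forecast «only the K row can decide ⇒ UNDECIDED AT BUDGET» proved before any number

Venture CertifiedManyBodySolver, cell `pub/hubbard-downfold`, seat hubbard-downfold-score-2 (gen 19); namespace
`Summit.Ventures.CertifiedManyBodySolver.Downfold.CMOPilot`. Everything here is PROVED (no `sorry`, standard axioms).

The C-MO card A12 («spin-inert certificate») is piloted on the three AV₃Sb₅ rows K / Rb / Cs (run-8 g11 job «v11si6», ≤ 30 core-h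
hard line). Per row two spin-polarised STARTS are run — s2α (18-atom stripe) and s2β (in-cell UUD) — and each start ENDS in one of three
states: CONVERGED with its largest site moment KEPT (max |m| ≥ 0.05 μ_B), CONVERGED with every moment COLLAPSED (< 0.05 μ_B), or CUT /
unconverged at the wall. RULING R-vj made the reading rule for partial data explicit:

* (C) a row is DECIDED NO-FIRE as soon as EITHER start ends converged-kept (the other start may be unconverged or cut); DECIDED FIRE needs
  BOTH starts converged AND collapsed; everything else is UNDECIDED;
* (D) verdict over the three rows: ≥ 2 FIRE ⇒ «A12 AS WORDED FAILS ITS ADOPTION CLAUSE» (C-MO closes); ≥ 2 NO-FIRE ⇒ «A12 SURVIVES SI-6′ (ii)»;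
  any other count ⇒ «SI-6′ (ii) UNDECIDED AT BUDGET» (neither closes C-MO nor arms leg (iii));
* run-8's honest forecast (l.9055, before numbers): by the kill line only the K row can decide, Rb / Cs end UNDECIDED.

This file: §1 the start states, the row reading `rowReading` and its closed forms (`rowReading_eq_nofire_iff` — one kept start decides
NO-FIRE whatever the other start does; `rowReading_eq_fire_iff`; `rowReading_eq_undecided_iff`); §2 the verdict `verdict` on a row list
with its counts, and on THREE rows: the two decided verdicts are mutually exclusive (`not_two_fire_and_two_nofire_of_three`), a decided
verdict is STABLE under refining an undecided row (`verdict_fails_stable`, `verdict_survives_stable` — more data never flips FAILS ↔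
SURVIVES), and THE FORECAST AS A THEOREM: with two rows UNDECIDED the verdict is «UNDECIDED AT BUDGET» whatever the third row reads
(`verdict_undecided_of_two_undecided`) — so the pilot's verdict at the 30-core-h line is fixed BEFORE K's moments are read, unless Rb or Cs
decides after all; §3 the score side the verdict grammar feeds (score-2's standing confirmation «by table STATUS l.8145», kernel twin of
`RouterWordScoreV8PreregG17` §4): on the AV₃Sb₅ typing «EPH+UND:STRUCT ∣ UND:MIXED+EPH» an A12-fired re-word «EPH(spin-inert …)» reads
PARTIAL (a LOSS from today's AGREE «UND:MIXED+EPH»), the fired word WITH the structure rider «EPH(spin-inert)+UND:STRUCT» reads AGREE (inert),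
so a FIRE row costs exactly one AGREE → PARTIAL cell per worded column and never a DISAGREE (`fire_reword_cells`).

WHAT THIS IS NOT: not a statement about AV₃Sb₅ magnetism, not the pilot's numbers (run-8's job prints them), not a ruling (R-vj is the
lead's; this is its kernel form) and not a recommendation on leg (iii).
-/

namespace Summit.Ventures.CertifiedManyBodySolver.Downfold

namespace CMOPilot

/-! ## §1 Start states and the row reading (R-vj (C)) -/

/-- How one spin-polarised start ENDS: converged with a kept moment (max |m| ≥ 0.05 μ_B), converged with every moment collapsed, or
cut / unconverged at the wall. [folklore] -/
inductive StartEnd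
  | kept
  | collapsed
  | cut
  deriving DecidableEq, Repr

/-- The three row readings of R-vj (C). [folklore] -/
inductive RowReading
  | NOFIRE
  | FIRE
  | UNDECIDED
  deriving DecidableEq, Repr

open StartEnd RowReading

/-- R-vj (C): NO-FIRE as soon as either start ends converged-kept; FIRE iff both converged-collapsed; else UNDECIDED. [folklore] -/
def rowReading (α β : StartEnd) : RowReading :=
  if α = kept ∨ β = kept then NOFIRE
  else if α = collapsed ∧ β = collapsed then FIRE
  else UNDECIDED

/-- ONE KEPT START DECIDES NO-FIRE, whatever the other start does (converged, collapsed, cut). [folklore] -/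
theorem rowReading_eq_nofire_iff (α β : StartEnd) : rowReading α β = NOFIRE ↔ α = kept ∨ β = kept := by
  cases α <;> cases β <;> decide

/-- FIRE needs BOTH starts converged and collapsed. [folklore] -/
theorem rowReading_eq_fire_iff (α β : StartEnd) : rowReading α β = FIRE ↔ α = collapsed ∧ β = collapsed := by
  cases α <;> cases β <;> decide

/-- UNDECIDED = no kept start and at least one start cut. [folklore] -/
theorem rowReading_eq_undecided_iff (α β : StartEnd) :
    rowReading α β = UNDECIDED ↔ (α ≠ kept ∧ β ≠ kept) ∧ (α = cut ∨ β = cut) := by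
  cases α <;> cases β <;> decide

/-- R-vj (C) «report K(β)'s converged site moments … even if K(α) is cut by the wall: a kept β moment decides K alone». [folklore] -/
theorem kept_beta_decides_alone (α : StartEnd) : rowReading α kept = NOFIRE := by
  cases α <;> decide

/-- … and a collapsed β with α cut does NOT decide (FIRE needs both). [folklore] -/
theorem collapsed_beta_alone_undecided : rowReading cut collapsed = UNDECIDED := by decide

/-- The reading is symmetric in the two starts. [folklore] -/
theorem rowReading_comm (α β : StartEnd) : rowReading α β = rowReading β α := by
  cases α <;> cases β <;> decide

/-! ## §2 The verdict grammar (R-vj (D)) -/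

/-- The three verdicts of R-vj (D). [folklore] -/
inductive Verdict
  /-- ≥ 2 FIRE: «A12 AS WORDED FAILS ITS ADOPTION CLAUSE ⇒ C-MO CLOSES» -/
  | FAILS
  /-- ≥ 2 NO-FIRE: «A12 SURVIVES SI-6′ (ii)» (leg (iii) goes to the director at the re-priced cost) -/
  | SURVIVES
  /-- any other count: «SI-6′ (ii) UNDECIDED AT BUDGET» (neither closes C-MO nor arms leg (iii)) -/
  | UNDECIDED_AT_BUDGET
  deriving DecidableEq, Repr

open Verdict

/-- number of rows reading `r` [folklore] -/
def count (r : RowReading) (rows : List RowReading) : ℕ := (rows.filter (· = r)).length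

/-- R-vj (D) as a total function (FIRE clause first, as written). [folklore] -/
def verdict (rows : List RowReading) : Verdict :=
  if 2 ≤ count FIRE rows then FAILS
  else if 2 ≤ count NOFIRE rows then SURVIVES
  else UNDECIDED_AT_BUDGET

/-- On THREE rows the two decided verdicts are mutually exclusive (so the clause order in `verdict` is immaterial for the pilot).
[folklore] -/
theorem not_two_fire_and_two_nofire_of_three (a b c : RowReading) :
    ¬ (2 ≤ count FIRE [a, b, c] ∧ 2 ≤ count NOFIRE [a, b, c]) := by
  cases a <;> cases b <;> cases c <;> decide

/-- `verdict` on three rows, both clause orders agree. [folklore] -/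
theorem verdict_three_order_free (a b c : RowReading) :
    verdict [a, b, c] =
      (if 2 ≤ count NOFIRE [a, b, c] then SURVIVES
       else if 2 ≤ count FIRE [a, b, c] then FAILS else UNDECIDED_AT_BUDGET) := by
  cases a <;> cases b <;> cases c <;> decide

/-- THE FORECAST AS A THEOREM (run-8 l.9055, R-vj (B)/(D)): with two of the three rows UNDECIDED at the kill line, the pilot's verdict is
«UNDECIDED AT BUDGET» WHATEVER THE THIRD ROW READS — fixed before K's moments are printed. [folklore] -/
theorem verdict_undecided_of_two_undecided (k : RowReading) :
    verdict [k, UNDECIDED, UNDECIDED] = UNDECIDED_AT_BUDGET ∧ verdict [UNDECIDED, k, UNDECIDED] = UNDECIDED_AT_BUDGET ∧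
    verdict [UNDECIDED, UNDECIDED, k] = UNDECIDED_AT_BUDGET := by
  cases k <;> decide

/-- Conversely a decided pilot verdict needs at least two DECIDED rows reading alike. [folklore] -/
theorem two_alike_of_decided (a b c : RowReading) (h : verdict [a, b, c] ≠ UNDECIDED_AT_BUDGET) :
    2 ≤ count FIRE [a, b, c] ∨ 2 ≤ count NOFIRE [a, b, c] := by
  revert h; cases a <;> cases b <;> cases c <;> decide

/-- `refines r r'`: `r'` is a legitimate later reading of a row now read `r` — decided readings are final, an UNDECIDED row may become
anything (more iterations, a converged start). [folklore] -/
def refines (r r' : RowReading) : Bool := decide (r = UNDECIDED) || decide (r' = r)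

/-- STABILITY OF «FAILS»: once two rows FIRE, no later reading of the rows un-fails the pilot. [folklore] -/
theorem verdict_fails_stable (a b c a' b' c' : RowReading) (ha : refines a a' = true) (hb : refines b b' = true)
    (hc : refines c c' = true) (h : verdict [a, b, c] = FAILS) : verdict [a', b', c'] = FAILS := by
  revert ha hb hc h; cases a <;> cases b <;> cases c <;> cases a' <;> cases b' <;> cases c' <;> decide

/-- STABILITY OF «SURVIVES»: once two rows read NO-FIRE, no later reading of the third row flips the pilot to FAILS or back to
UNDECIDED. [folklore] -/
theorem verdict_survives_stable (a b c a' b' c' : RowReading) (ha : refines a a' = true) (hb : refines b b' = true)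
    (hc : refines c c' = true) (h : verdict [a, b, c] = SURVIVES) : verdict [a', b', c'] = SURVIVES := by
  revert ha hb hc h; cases a <;> cases b <;> cases c <;> cases a' <;> cases b' <;> cases c' <;> decide

/-- … whereas «UNDECIDED AT BUDGET» is the only verdict more core-hours can move (e.g. Rb deciding NO-FIRE beside a NO-FIRE K).
[folklore] -/
theorem undecided_can_move :
    verdict [NOFIRE, UNDECIDED, UNDECIDED] = UNDECIDED_AT_BUDGET ∧ verdict [NOFIRE, NOFIRE, UNDECIDED] = SURVIVES ∧
    verdict [FIRE, UNDECIDED, UNDECIDED] = UNDECIDED_AT_BUDGET ∧ verdict [FIRE, FIRE, UNDECIDED] = FAILS := by decide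

/-- The row-level chain: a kept β on K with Rb / Cs cut at the wall ⇒ K NO-FIRE, pilot UNDECIDED AT BUDGET; had Rb's β also ended kept,
SURVIVES. [folklore] -/
theorem pilot_at_kill_line (αK αRb αCs : StartEnd) :
    verdict [rowReading αK kept, rowReading αRb cut, rowReading αCs cut] =
      (if αRb = kept ∨ αCs = kept then SURVIVES else UNDECIDED_AT_BUDGET) := by
  cases αK <;> cases αRb <;> cases αCs <;> decide

/-! ## §3 The score side a FIRE feeds (score-2's confirmation table STATUS l.8145; twin of `RouterWordScoreV8PreregG17` §4) -/

open RouterScore RouterScore.Head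

/-- The AV₃Sb₅ typing of record «EPH+UND:STRUCT ∣ UND:MIXED+EPH» (M346 CsV₃Sb₅ @0/@3, M347 KV₃Sb₅, M348 RbV₃Sb₅). [folklore] -/
def av3sb5 : List (List Head) := [[eph, undStruct], [undMixed, eph]]

/-- What a FIRE does to a worded AV₃Sb₅ cell: today's located word «UND:MIXED+EPH» is AGREE; the A12-fired re-word «EPH(spin-inert …)»
(bare EPH head, payload in parentheses, no rider) is PARTIAL — a LOSS, never a DISAGREE (the «EPH+UND:STRUCT» alternative is EPH-led);
the fired word carrying the structure rider «EPH(spin-inert)+UND:STRUCT» is AGREE (the family is then INERT to A12). A NO-FIRE or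
UNDECIDED row carries no re-word, so nothing is scored. [folklore] -/
theorem fire_reword_cells :
    score [undMixed, eph] av3sb5 = .AGREE ∧ score [eph] av3sb5 = .PARTIAL ∧ score [eph, undStruct] av3sb5 = .AGREE ∧
    score [undMixed, eph, undStruct] av3sb5 = .AGREE ∧ score [eph] av3sb5 ≠ .DISAGREE := by decide

/-- Hence the pilot can register at most ONE AGREE → PARTIAL loss per worded cell of a FIRE row and no KILL-unit (new DISAGREE) at all —
the reading score-2 g17 filed before the pilot was priced (Q-sv-1). [folklore] -/
theorem fire_never_kills (tl : List Head) : score (eph :: tl) av3sb5 ≠ .DISAGREE := by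
  unfold score av3sb5
  rw [outcome_cons, if_neg (by decide), if_neg (by decide)]
  have hq : [[eph, undStruct], [undMixed, eph]].any (primaryEmitted (eph :: tl)) = true := by
    rw [List.any_eq_true]; exact ⟨[eph, undStruct], by simp, by simp [primaryEmitted]⟩
  by_cases hm : [[eph, undStruct], [undMixed, eph]].any (fullMatch (eph :: tl)) = true
  · rw [if_pos hm]; decide
  · rw [if_neg hm, if_pos hq]; decide

end CMOPilot

end Summit.Ventures.CertifiedManyBodySolver.Downfold
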